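import Mathlib
import HarnessLib
import Summits.NavierStokesRegularity.NavierStokesRegularity.Theorems.TypeIQuarterGateScarEnvelopeTypeIForcedTsaiAlgSoundX
import Summits.NavierStokesRegularity.NavierStokesRegularity.Theorems.TypeIQuarterGateScarEnvelopeTypeIForcedTsaiAlgWitnessGX8
import Summits.NavierStokesRegularity.NavierStokesRegularity.Theorems.TypeIQuarterGateScarEnvelopeTypeIForcedTsaiAlgWitnessGX16

/-!
# ARM B lane E-exact — LARGER-BASIS Type-I rows AT LEVELS 16 and 8 EXACTLY (eng-3 g2 j320791 rescale of j319388), exact level + exact weight, AS TREE THEOREMS: δ/M = 17.885 @16 · 16.480 @8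

Closers of kernel-checked LANEX-ALG v4 rows — EXACT level `‖ω‖_{L²(B₁₀)}` (incomplete-Beta recurrences) and EXACT residual
weight `(1+ρ)⁵`; no floor, no majorant — through `AlgRowX.sound` (`…ForcedTsaiAlgSoundX`): certified UPPER bounds on the
forced-Tsai modulus in the tree currency (`ℝ³`, weight `(1+ρ)⁵`, level on `B₁₀`).
WITNESS: ns-wall-eng-3 g2's larger-basis vectors rescaled to the exact B₁₀ levels 16.0064 / 8.0032 with the closure re-solved in ℚ (kit j320791; rowX_nl_GX_M16/M8.json sha16 637da055aba98791 / 51b21c9cd623f003; certifier = cert hand ns-crc-p2 g6).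
`δ*(8) ≤ 131.8` (δ/M = 16.480); `δ*(16) ≤ 286.2` (δ/M = 17.884).
«Near-profiles this good EXIST»; UPPER bounds only; excludes nothing; nothing about NS regularity; 23843 / H3 OPEN.
-/

set_option linter.dupNamespace false

namespace Summit.NavierStokesRegularity.NavierStokesRegularity.Cruxes.ScarEnvelopeTypeI.ForcedTsai

/-- `δ*(8) ≤ 131839/1000` ≈ 131.8390 at the EXACT `B₁₀` level `M = 8` (Type-I-tail class, exact closure, exact weight; δ/M = 16.480). -/
theorem forcedTsaiModulusLE_algX_GX_8 : ForcedTsaiModulusLE (8 : ℝ) (131839 / 1000 : ℝ) := by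
  have h := algRowXGX8r0.sound algRowXGX8r0_checkX
  have hM : algRowXGX8r0.M = 8 := rfl
  have hδ : algRowXGX8r0.δ = (131839 / 1000) := rfl
  rw [hM, hδ] at h
  push_cast at h
  exact h

/-- `δ*(16) ≤ 35769/125` ≈ 286.1520 at the EXACT `B₁₀` level `M = 16` (Type-I-tail class, exact closure, exact weight; δ/M = 17.884). -/
theorem forcedTsaiModulusLE_algX_GX_16 : ForcedTsaiModulusLE (16 : ℝ) (35769 / 125 : ℝ) := by
  have h := algRowXGX16r0.sound algRowXGX16r0_checkX
  have hM : algRowXGX16r0.M = 16 := rfl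
  have hδ : algRowXGX16r0.δ = (35769 / 125) := rfl
  rw [hM, hδ] at h
  push_cast at h
  exact h

/-- Rounded: `ForcedTsaiModulusLE 16 287` (`δ/M ≤ 17.94` at level 16; larger-basis vector, exact level and exact weight; cf. `…_16_293` v3). -/
theorem forcedTsaiModulusLE_16_287 : ForcedTsaiModulusLE (16 : ℝ) (287 : ℝ) :=
  forcedTsaiModulusLE_algX_GX_16.mono le_rfl (by norm_num)

/-- Rounded: `ForcedTsaiModulusLE 8 132` (`δ/M ≤ 16.5` at level 8; larger-basis vector, exact level and exact weight). -/
theorem forcedTsaiModulusLE_8_132 : ForcedTsaiModulusLE (8 : ℝ) (132 : ℝ) :=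
  forcedTsaiModulusLE_algX_GX_8.mono le_rfl (by norm_num)

end Summit.NavierStokesRegularity.NavierStokesRegularity.Cruxes.ScarEnvelopeTypeI.ForcedTsai
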